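import Summits.CriticalPhenomena.SAWScalingLimit.Theorems.SAWWeldingIdentificationWeldingSetupConfigB
import Literature.Probability.RandomPlanarGeometry.ChordalUniformizerConvergence
import Literature.Probability.RandomPlanarGeometry.CrossRatioContinuity

/-!
# Continuity of the conformal welding along simple chords: preliminaries
# (route `SAWWeldingIdentification`, helper for item `WeldingSetup`, stmt-CriticalPhenomena-4504)

Ingredients of the continuity of `γ ↦ conformalWelding Q γ x` on simple chords (closing file
`SAWWeldingIdentificationWeldingSetup`):

* `conformalWelding_spec_chordal`, `conformalWelding_eq_of_chordal` — the welding read through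
  ARBITRARY chordal uniformisers `φ₀ : ℍ → L`, `ψ₀ : ℍ → R` of the two banks (`0 ↦ a`, `∞ ↦ b`, no
  third-point normalisation) with `φ₀(t) = c_L`, `ψ₀(u) = c_R`: `y = W Q γ x` is the unique solution
  of `ψ₀(-u x) = φ₀(-t y)` (normalise by the dilations `|t|`, `|u|`; the signs of `t`, `u` are
  opposite by the orientation rule);
* `exists_reps_tendstoUniformly` — converging simple curve classes have uniformly converging
  injective representatives; `param_of_rep`, `tendstoUniformly_param` — their real-line
  parametrisations; `tendstoUniformly_loop_left`, `tendstoUniformly_loop_right` — the glued bank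
  loops converge uniformly;
* `tendsto_real_of_boundaryExtension` — PREIMAGE CONVERGENCE: if boundary correspondences of
  chordal uniformisers converge uniformly on the closed half-plane (U1) with control at infinity
  (U2) — the output of Radó's theorem in the tree's form
  `MarkedDomain.exists_uniformizers_of_tendstoUniformly_boundary` — then real preimages of
  converging boundary points converge;
* `exists_bankPair` — a simple chord has a bank pair satisfying the route's clause.

References: Ch. Pommerenke, *Boundary Behaviour of Conformal Maps* (1992), Thm. 2.11, Cor. 2.4,
Thm. 2.6, Cor. 2.7; T. Radó (1923).
-/

noncomputable section

namespace Summit.CriticalPhenomena.SAWScalingLimit.Theorems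

open Set Filter Topology Complex Metric Function
open UpperHalfPlane (upperHalfPlaneSet)
open Literature.Probability.RandomPlanarGeometry Literature.Topology.PlaneTopology

section Chordal

variable {Q : ConformalRectangle} {γ : CurveClass ℂ}

/-! ### The welding read through arbitrary chordal uniformisers of the banks -/

/-- **The welding through un-normalised chordal uniformisers.** Let `φ₀ : ℍ → L`, `ψ₀ : ℍ → R`
be chordal uniformisers of the two banks (`0 ↦ a`, `∞ ↦ b`, no third-point normalisation), with
`φ₀(t) = c_L`, `ψ₀(u) = c_R`. Then for `x > 0` the conformal welding `y = W Q γ x` is positive and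
satisfies `ψ₀(-u x) = φ₀(-t y)` (normalise by the dilations `|t|`, `|u|`; the signs of `t`, `u`
are opposite by the orientation rule). [folklore] -/
theorem conformalWelding_spec_chordal (hγ : (Q.chord 0 2 (by decide)).IsSimpleChord γ) {L R : Set ℂ}
    (hb : L ∪ R = Q.carrier \ γ.range ∧ Disjoint L R ∧ IsOpen L ∧ IsOpen R ∧ IsConnected L ∧
      IsConnected R ∧ Q.pt 1 ∈ closure L ∧ Q.pt 3 ∈ closure R)
    (φ₀ : ConformalEquiv upperHalfPlaneSet L) (ψ₀ : ConformalEquiv upperHalfPlaneSet R)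
    (hφ0 : φ₀.HasBoundaryValue 0 (Q.pt 0)) (hφi : φ₀.HasBoundaryValueAtInfty (Q.pt 2))
    (hψ0 : ψ₀.HasBoundaryValue 0 (Q.pt 0)) (hψi : ψ₀.HasBoundaryValueAtInfty (Q.pt 2))
    {t u : ℝ} (ht : φ₀.boundaryExtension t = Q.pt 1) (hu : ψ₀.boundaryExtension u = Q.pt 3)
    {x : ℝ} (hx : 0 < x) :
    0 < conformalWelding Q γ x ∧ ψ₀.boundaryExtension ((-(u * x) : ℝ) : ℂ) =
      φ₀.boundaryExtension ((-(t * conformalWelding Q γ x) : ℝ) : ℂ) := by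
  obtain ⟨Φ, hΦ⟩ := MarkedDomain.exists_isChordalUniformizing_holds (Q.chord 0 2 (by decide))
  obtain ⟨tL, htL0, htL⟩ := exists_boundaryExtension_eq_pt_one Φ hΦ
  obtain ⟨p, hp, hpinj, hprange, hp0, hp1⟩ := exists_param_of_isSimpleChord hγ
  obtain ⟨DL, hDL, hLa, hLb, -⟩ := exists_leftBank_dobrushinDomain hγ hb hp hpinj hprange hp0 hp1
  obtain ⟨DR, hDR, hRa, hRb, -⟩ := exists_rightBank_dobrushinDomain hγ hb hp hpinj hprange hp0 hp1
  subst hDL hDR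
  -- boundary values at `t`, `u`
  have hφt : φ₀.HasBoundaryValue t (Q.pt 1) := ht ▸ tendsto_boundaryExtension_ofReal φ₀ t
  have hψu : ψ₀.HasBoundaryValue u (Q.pt 3) := hu ▸ tendsto_boundaryExtension_ofReal ψ₀ u
  -- `t`, `u` are nonzero with opposite signs, by the orientation rule
  have ht0 : t ≠ 0 := by
    rintro rfl
    have h0 := boundaryExtension_zero_of_isChordalUniformizing φ₀ ⟨by rw [hLa]; exact hφ0, by rw [hLb]; exact hφi⟩
    rw [hLa] at h0
    exact absurd (Q.pt_injective (h0.symm.trans ht)) (by decide)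
  have hu0 : u ≠ 0 := by
    rintro rfl
    have h0 := boundaryExtension_zero_of_isChordalUniformizing ψ₀ ⟨by rw [hRa]; exact hψ0, by rw [hRb]; exact hψi⟩
    rw [hRa] at h0
    exact absurd (Q.pt_injective (h0.symm.trans hu)) (by decide)
  set s : ℝ := if 0 < t then 1 else -1 with hsdef
  have hs : s = 1 ∨ s = -1 := by
    by_cases h0 : 0 < t
    · exact Or.inl (if_pos h0)
    · exact Or.inr (if_neg h0)
  have hts : |t| * s = t := by
    by_cases h0 : 0 < t
    · rw [show s = 1 from if_pos h0, mul_one, abs_of_pos h0]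
    · rw [show s = -1 from if_neg h0, mul_neg_one, abs_of_neg (lt_of_le_of_ne (not_lt.1 h0) ht0), neg_neg]
  have hus : |u| * (-s) = u := by
    by_cases h0 : 0 < t
    · -- `t > 0` forces `t_L > 0`, hence `u < 0`
      have htL' : 0 < tL := by
        by_contra hc
        have := sign_left_neg hγ Φ hΦ htL hb φ₀ hφ0 hφi (lt_of_le_of_ne (not_lt.1 hc) htL0) hφt
        linarith
      have hu' : u < 0 := sign_right_pos hγ Φ hΦ htL hb ψ₀ hψ0 hψi htL' hψu
      rw [show s = 1 from if_pos h0, mul_neg_one, abs_of_neg hu', neg_neg]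
    · have ht' : t < 0 := lt_of_le_of_ne (not_lt.1 h0) ht0
      have htL' : tL < 0 := by
        by_contra hc
        have := sign_left_pos hγ Φ hΦ htL hb φ₀ hφ0 hφi (lt_of_le_of_ne (not_lt.1 hc) (Ne.symm htL0)) hφt
        linarith
      have hu' : 0 < u := sign_right_neg hγ Φ hΦ htL hb ψ₀ hψ0 hψi htL' hψu
      rw [show s = -1 from if_neg h0, neg_neg, mul_one, abs_of_pos hu']
  -- the normalised configuration
  have hl : 0 < |t| := abs_pos.2 ht0
  have hm : 0 < |u| := abs_pos.2 hu0
  set φ : ConformalEquiv upperHalfPlaneSet DL.carrier := (ConformalEquiv.smulUpperHalfPlane |t| hl).trans φ₀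
  set ψ : ConformalEquiv upperHalfPlaneSet DR.carrier := (ConformalEquiv.smulUpperHalfPlane |u| hm).trans ψ₀
  have hφ₀c : DL.IsChordalUniformizing φ₀ := ⟨by rw [hLa]; exact hφ0, by rw [hLb]; exact hφi⟩
  have hψ₀c : DR.IsChordalUniformizing ψ₀ := ⟨by rw [hRa]; exact hψ0, by rw [hRb]; exact hψi⟩
  have hφ : DL.IsChordalUniformizing φ := hφ₀c.smul_trans _ hl
  have hψ : DR.IsChordalUniformizing ψ := hψ₀c.smul_trans _ hm
  have hφs : φ.HasBoundaryValue ((s : ℝ) : ℂ) (Q.pt 1) :=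
    hasBoundaryValue_smul_trans φ₀ hl (by rw [hts]; exact hφt)
  have hψs : ψ.HasBoundaryValue (-((s : ℝ) : ℂ)) (Q.pt 3) := by
    rw [← ofReal_neg]
    exact hasBoundaryValue_smul_trans ψ₀ hm (by rw [hus]; exact hψu)
  let c : WeldingConfig Q γ := ⟨s, DL.carrier, DR.carrier, φ, ψ, hs, hb, hLa ▸ hφ.1, hLb ▸ hφ.2, hφs,
    hRa ▸ hψ.1, hRb ▸ hψ.2, hψs⟩
  obtain ⟨hpos, hW⟩ := conformalWelding_pos_and_isWeld hγ c hx
  refine ⟨hpos, ?_⟩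
  have hW' : ψ.boundaryExtension ((s * x : ℝ) : ℂ) =
      φ.boundaryExtension ((-(s * conformalWelding Q γ x) : ℝ) : ℂ) := hW
  rw [boundaryExtension_smul_trans ψ₀ hm, boundaryExtension_smul_trans φ₀ hl] at hW'
  have e1 : |u| * (s * x) = -(u * x) := by
    conv_rhs => rw [← hus]
    ring
  have e2 : |t| * -(s * conformalWelding Q γ x) = -(t * conformalWelding Q γ x) := by
    conv_rhs => rw [← hts]
    ring
  rw [e1, e2] at hW'
  exact hW'

/-- **Uniqueness through un-normalised chordal uniformisers**: with the notation of
`conformalWelding_spec_chordal`, any `y > 0` with `ψ₀(-u x) = φ₀(-t y)` equals `W Q γ x`.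
[folklore] -/
theorem conformalWelding_eq_of_chordal (hγ : (Q.chord 0 2 (by decide)).IsSimpleChord γ) {L R : Set ℂ}
    (hb : L ∪ R = Q.carrier \ γ.range ∧ Disjoint L R ∧ IsOpen L ∧ IsOpen R ∧ IsConnected L ∧
      IsConnected R ∧ Q.pt 1 ∈ closure L ∧ Q.pt 3 ∈ closure R)
    (φ₀ : ConformalEquiv upperHalfPlaneSet L) (ψ₀ : ConformalEquiv upperHalfPlaneSet R)
    (hφ0 : φ₀.HasBoundaryValue 0 (Q.pt 0)) (hφi : φ₀.HasBoundaryValueAtInfty (Q.pt 2))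
    (hψ0 : ψ₀.HasBoundaryValue 0 (Q.pt 0)) (hψi : ψ₀.HasBoundaryValueAtInfty (Q.pt 2))
    {t u : ℝ} (ht : φ₀.boundaryExtension t = Q.pt 1) (hu : ψ₀.boundaryExtension u = Q.pt 3)
    {x y : ℝ} (hx : 0 < x)
    (hw : ψ₀.boundaryExtension ((-(u * x) : ℝ) : ℂ) = φ₀.boundaryExtension ((-(t * y) : ℝ) : ℂ)) :
    conformalWelding Q γ x = y := by
  obtain ⟨-, hW⟩ := conformalWelding_spec_chordal hγ hb φ₀ ψ₀ hφ0 hφi hψ0 hψi ht hu hx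
  obtain ⟨p, hp, hpinj, hprange, hp0, hp1⟩ := exists_param_of_isSimpleChord hγ
  obtain ⟨DL, hDL, hLa, hLb, -⟩ := exists_leftBank_dobrushinDomain hγ hb hp hpinj hprange hp0 hp1
  subst hDL
  have ht0 : t ≠ 0 := by
    rintro rfl
    have h0 := boundaryExtension_zero_of_isChordalUniformizing φ₀ ⟨by rw [hLa]; exact hφ0, by rw [hLb]; exact hφi⟩
    rw [hLa] at h0
    exact absurd (Q.pt_injective (h0.symm.trans ht)) (by decide)
  have h1 := JordanDomain.injOn_boundaryExtension φ₀ (by simp) (by simp) (hW.symm.trans hw)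
  have h2 : -(t * conformalWelding Q γ x) = -(t * y) := by exact_mod_cast h1
  exact mul_left_cancel₀ ht0 (neg_injective h2)

end Chordal

/-! ### Representatives of converging simple classes converge uniformly -/

/-- **Converging simple curve classes have uniformly converging injective representatives.**
If `γ_n → γ` in `CurveClass ℂ` with all classes simple, there are injective parametrisations
`g_n`, `g` of `γ_n`, `γ` with `g_n → g` uniformly on `[0, 1]` (pick near-optimal
reparametrisations in the infimum defining the quotient distance). [folklore] -/
theorem exists_reps_tendstoUniformly {γs : ℕ → CurveClass ℂ} {γ : CurveClass ℂ}
    (hγs : ∀ n, γs n ∈ CurveClass.simple) (hγ : γ ∈ CurveClass.simple)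
    (hlim : Tendsto γs atTop (𝓝 γ)) :
    ∃ (g : Curve ℂ) (gs : ℕ → Curve ℂ), Function.Injective g ∧ (∀ n, Function.Injective (gs n)) ∧
      CurveClass.mk g = γ ∧ (∀ n, CurveClass.mk (gs n) = γs n) ∧
      TendstoUniformly (fun n => ((gs n : Curve ℂ) : unitInterval → ℂ)) g atTop := by
  obtain ⟨g, hg, rfl⟩ := hγ
  choose g' hg' hmk using hγs
  have hd : Tendsto (fun n => dist (CurveClass.mk g) (CurveClass.mk (g' n))) atTop (𝓝 0) := by
    have h := (tendsto_iff_dist_tendsto_zero.1 hlim)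
    refine h.congr fun n => ?_
    rw [hmk n, dist_comm]
  -- near-optimal reparametrisations
  have hex : ∀ n, ∃ φ : unitInterval ≃o unitInterval,
      dist g.toContinuousMap ((g' n).reparam φ).toContinuousMap <
        dist (CurveClass.mk g) (CurveClass.mk (g' n)) + 1 / ((n : ℝ) + 1) := by
    intro n
    have hlt : Curve.reparamDist g (g' n) < dist (CurveClass.mk g) (CurveClass.mk (g' n)) + 1 / ((n : ℝ) + 1) := by
      rw [CurveClass.dist_mk_mk, Curve.dist_def]
      exact lt_add_of_pos_right _ (by positivity)
    exact exists_lt_of_ciInf_lt hlt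
  choose φ hφ using hex
  refine ⟨g, fun n => (g' n).reparam (φ n), hg, fun n => ?_, rfl, fun n => ?_, ?_⟩
  · intro a b hab
    have : (g' n) (φ n a) = (g' n) (φ n b) := hab
    exact (φ n).injective (hg' n this)
  · rw [CurveClass.mk_reparam, hmk]
  · rw [Metric.tendstoUniformly_iff]
    intro ε hε
    have h1 : Tendsto (fun n => dist (CurveClass.mk g) (CurveClass.mk (g' n)) + 1 / ((n : ℝ) + 1)) atTop
        (𝓝 0) := by
      simpa using hd.add tendsto_one_div_add_atTop_nhds_zero_nat
    filter_upwards [(tendsto_order.1 h1).2 ε hε] with n hn t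
    calc dist (g t) (((g' n).reparam (φ n)) t)
        ≤ dist g.toContinuousMap ((g' n).reparam (φ n)).toContinuousMap :=
          ContinuousMap.dist_apply_le_dist t
      _ < ε := (hφ n).trans hn

/-- The real-line parametrisation `t ↦ g (projIcc t)` of an injective representative of a
simple chord: continuous, injective on `[0, 1]`, tracing the chord from `a` to `b`. [folklore] -/
theorem param_of_rep {Q : ConformalRectangle} {γ : CurveClass ℂ}
    (hγ : (Q.chord 0 2 (by decide)).IsSimpleChord γ) {g : Curve ℂ} (hg : Function.Injective g)
    (hmk : CurveClass.mk g = γ) :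
    Continuous (fun t : ℝ => g (projIcc 0 1 zero_le_one t)) ∧
      InjOn (fun t : ℝ => g (projIcc 0 1 zero_le_one t)) (Icc 0 1) ∧
      (fun t : ℝ => g (projIcc 0 1 zero_le_one t)) '' Icc 0 1 = γ.range ∧
      (fun t : ℝ => g (projIcc 0 1 zero_le_one t)) 0 = Q.pt 0 ∧
      (fun t : ℝ => g (projIcc 0 1 zero_le_one t)) 1 = Q.pt 2 := by
  have hs : γ.source = Q.pt 0 := hγ.2.1
  have ht : γ.target = Q.pt 2 := hγ.2.2.1
  subst hmk
  refine ⟨g.continuous.comp continuous_projIcc, ?_, ?_, ?_, ?_⟩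
  · intro s hs' t ht' h
    have h1 : projIcc 0 1 zero_le_one s = projIcc 0 1 zero_le_one t := hg h
    rw [projIcc_of_mem _ hs', projIcc_of_mem _ ht'] at h1
    exact congrArg Subtype.val h1
  · ext z
    constructor
    · rintro ⟨t, -, rfl⟩
      exact ⟨_, rfl⟩
    · rintro ⟨u, rfl⟩
      exact ⟨u, u.2, by simp [projIcc_of_mem _ u.2]⟩
  · simpa [Curve.source_def, projIcc_of_mem _ (left_mem_Icc.2 (zero_le_one' ℝ))] using hs
  · simpa [Curve.target_def, projIcc_of_mem _ (right_mem_Icc.2 (zero_le_one' ℝ))] using ht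

/-- Uniform convergence of representatives gives uniform convergence of the real-line
parametrisations. [folklore] -/
theorem tendstoUniformly_param {gs : ℕ → Curve ℂ} {g : Curve ℂ}
    (h : TendstoUniformly (fun n => ((gs n : Curve ℂ) : unitInterval → ℂ)) g atTop) :
    TendstoUniformly (fun n (t : ℝ) => gs n (projIcc 0 1 zero_le_one t))
      (fun t : ℝ => g (projIcc 0 1 zero_le_one t)) atTop := by
  rw [Metric.tendstoUniformly_iff] at h ⊢
  intro ε hε
  filter_upwards [h ε hε] with n hn t
  exact hn _

/-! ### Glued loops converge uniformly -/

/-- Uniform convergence of the chord parametrisations gives uniform convergence of the left-bank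
loops "arc, then chord backwards". [folklore] -/
theorem tendstoUniformly_loop_left {α : ℝ → ℂ} {ps : ℕ → ℝ → ℂ} {p : ℝ → ℂ}
    (h : TendstoUniformly ps p atTop) :
    TendstoUniformly (fun n => concatPath α (fun t => ps n (1 - t)) ∘ Int.fract)
      (concatPath α (fun t => p (1 - t)) ∘ Int.fract) atTop := by
  rw [Metric.tendstoUniformly_iff] at h ⊢
  intro ε hε
  filter_upwards [h ε hε] with n hn t
  simp only [Function.comp_apply]
  rcases le_or_gt (Int.fract t) (1 / 2) with hle | hlt
  · rw [concatPath_of_le_half hle, concatPath_of_le_half hle, dist_self]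
    exact hε
  · rw [concatPath_of_half_lt hlt, concatPath_of_half_lt hlt]
    exact hn _

/-- Uniform convergence of the chord parametrisations gives uniform convergence of the right-bank
loops "chord, then arc". [folklore] -/
theorem tendstoUniformly_loop_right {α : ℝ → ℂ} {ps : ℕ → ℝ → ℂ} {p : ℝ → ℂ}
    (h : TendstoUniformly ps p atTop) :
    TendstoUniformly (fun n => concatPath (ps n) α ∘ Int.fract) (concatPath p α ∘ Int.fract) atTop := by
  rw [Metric.tendstoUniformly_iff] at h ⊢
  intro ε hε
  filter_upwards [h ε hε] with n hn t
  simp only [Function.comp_apply]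
  rcases le_or_gt (Int.fract t) (1 / 2) with hle | hlt
  · rw [concatPath_of_le_half hle, concatPath_of_le_half hle]
    exact hn _
  · rw [concatPath_of_half_lt hlt, concatPath_of_half_lt hlt, dist_self]
    exact hε

/-! ### Real preimages of converging boundary points converge -/

/-- **Preimage convergence under converging boundary correspondences.** Let `φ_n : ℍ → D_n`,
`φ : ℍ → D` be chordal uniformisers whose boundary extensions converge uniformly on the closed
half-plane (U1) and are uniformly close to `b_n` near infinity (U2), with `b_n → b`. If real
points `τ_n` satisfy `φ_n(τ_n) = q_n → q = φ(τ)` (`τ` real), then `τ_n → τ`: the `τ_n` stay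
bounded by (U2) (`q ≠ b`), and on a compact interval the limit correspondence is a continuous
injection, so `φ(τ_n) → q` forces `τ_n → τ` (`tendsto_of_injOn_of_tendsto_comp`). [folklore] -/
theorem tendsto_real_of_boundaryExtension {Ds : ℕ → DobrushinDomain} {D : DobrushinDomain}
    (φ : ConformalEquiv upperHalfPlaneSet D.carrier) (hφ : D.IsChordalUniformizing φ)
    (φs : ∀ n, ConformalEquiv upperHalfPlaneSet (Ds n).carrier)
    (hU1 : TendstoUniformlyOn (fun n => (φs n).boundaryExtension) φ.boundaryExtension atTop
      {z : ℂ | 0 ≤ z.im})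
    (hU2 : ∀ ε : ℝ, 0 < ε → ∃ r : ℝ, ∀ᶠ n in atTop, ∀ z : ℂ, z ∈ {z : ℂ | 0 ≤ z.im} → r ≤ ‖z‖ →
      dist ((φs n).boundaryExtension z) ((Ds n).pt 1) ≤ ε)
    (hb : Tendsto (fun n => (Ds n).pt 1) atTop (𝓝 (D.pt 1)))
    {τs : ℕ → ℝ} {τ : ℝ} {qs : ℕ → ℂ} {q : ℂ}
    (hq : ∀ n, (φs n).boundaryExtension (τs n) = qs n) (hqs : Tendsto qs atTop (𝓝 q))
    (hτ : φ.boundaryExtension τ = q) : Tendsto τs atTop (𝓝 τ) := by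
  -- `q ≠ b`
  have hqb : q ≠ D.pt 1 := hτ ▸ MarkedDomain.boundaryExtension_ofReal_ne_pt_one
    JordanDomain.exists_continuousOn_extension_holds hφ τ
  have hε : 0 < dist q (D.pt 1) / 3 := by
    have := dist_pos.2 hqb
    positivity
  -- the `τ_n` are eventually bounded
  obtain ⟨r, hr⟩ := hU2 _ hε
  set M : ℝ := max r (|τ| + 1) with hM
  have hbound : ∀ᶠ n in atTop, |τs n| < M := by
    filter_upwards [hr, Metric.tendsto_nhds.1 hqs _ hε, Metric.tendsto_nhds.1 hb _ hε] with n h1 h2 h3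
    by_contra hle
    have hle' : r ≤ ‖((τs n : ℝ) : ℂ)‖ := by
      rw [norm_real, Real.norm_eq_abs]
      exact (le_max_left _ _).trans (not_lt.1 hle)
    have h4 := h1 _ (by simp) hle'
    rw [hq n] at h4
    have : dist q (D.pt 1) ≤ dist q (qs n) + dist (qs n) ((Ds n).pt 1) + dist ((Ds n).pt 1) (D.pt 1) :=
      dist_triangle4 _ _ _ _
    rw [dist_comm q (qs n)] at this
    linarith
  -- the compact interval and the limit correspondence on it
  set K : Set ℂ := (fun t : ℝ => (t : ℂ)) '' Icc (-M) M with hK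
  have hKc : IsCompact K := isCompact_Icc.image continuous_ofReal
  have hKsub : K ⊆ {z : ℂ | 0 ≤ z.im} := by
    rintro _ ⟨t, -, rfl⟩
    simp
  have hcont : ContinuousOn φ.boundaryExtension K := by
    have h := JordanDomain.continuousOn_boundaryExtension_holds D.toJordanDomain φ
    rw [ConformalEquiv.closure_upperHalfPlaneSet_eq] at h
    exact h.mono hKsub
  have hinj : InjOn φ.boundaryExtension K := (JordanDomain.injOn_boundaryExtension φ).mono hKsub
  have hτK : (τ : ℂ) ∈ K := ⟨τ, ⟨by
    have : |τ| < M := lt_of_lt_of_le (lt_add_one _) (le_max_right _ _)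
    rw [abs_lt] at this; exact this.1.le, by
    have : |τ| < M := lt_of_lt_of_le (lt_add_one _) (le_max_right _ _)
    rw [abs_lt] at this; exact this.2.le⟩, rfl⟩
  have hg : ∀ᶠ n in atTop, ((τs n : ℝ) : ℂ) ∈ K := by
    filter_upwards [hbound] with n hn
    rw [abs_lt] at hn
    exact ⟨τs n, ⟨hn.1.le, hn.2.le⟩, rfl⟩
  -- `φ(τ_n) → q = φ(τ)`
  have hcomp : Tendsto (φ.boundaryExtension ∘ fun n => ((τs n : ℝ) : ℂ)) atTop (𝓝 (φ.boundaryExtension τ)) := by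
    rw [hτ]
    have h1 : Tendsto (fun n => (φs n).boundaryExtension (τs n)) atTop (𝓝 q) :=
      hqs.congr fun n => (hq n).symm
    refine h1.congr_dist ?_
    rw [Metric.tendsto_nhds]
    intro ε hε'
    filter_upwards [Metric.tendstoUniformlyOn_iff.1 hU1 ε hε'] with n hn
    rw [Real.dist_eq, sub_zero, abs_of_nonneg dist_nonneg, dist_comm]
    exact hn _ (by simp)
  have h := tendsto_of_injOn_of_tendsto_comp hKc hcont hinj hg hτK hcomp
  have h' : Tendsto (fun n => (((τs n : ℝ) : ℂ)).re) atTop (𝓝 ((τ : ℂ).re)) :=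
    (continuous_re.tendsto _).comp h
  simpa using h'

/-! ### A bank pair exists -/

/-- A simple chord has a bank pair satisfying the route's clause (Newman's two components, with
`c_L ∈ ∂U₁`, `c_R ∈ ∂U₂`). [folklore] -/
theorem exists_bankPair {Q : ConformalRectangle} {γ : CurveClass ℂ}
    (hγ : (Q.chord 0 2 (by decide)).IsSimpleChord γ) :
    ∃ L R : Set ℂ, L ∪ R = Q.carrier \ γ.range ∧ Disjoint L R ∧ IsOpen L ∧ IsOpen R ∧ IsConnected L ∧
      IsConnected R ∧ Q.pt 1 ∈ closure L ∧ Q.pt 3 ∈ closure R := by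
  obtain ⟨U₁, U₂, hU₁o, hU₂o, hU₁c, hU₂c, hdisj, hU, hf₁, hf₂⟩ := exists_banks hγ
  refine ⟨U₁, U₂, hU, hdisj, hU₁o, hU₂o, hU₁c, hU₂c, ?_, ?_⟩
  · rw [closure_eq_self_union_frontier, hf₁, image_Icc_left_eq]
    exact Or.inr (Or.inr (Or.inl (pt_one_mem_arc Q)))
  · rw [closure_eq_self_union_frontier, hf₂, image_Icc_right_eq]
    exact Or.inr (Or.inr (Or.inl (pt_three_mem_arc Q)))

end Summit.CriticalPhenomena.SAWScalingLimit.Theorems
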